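import Summits.HodgeConjecture.HodgeConjecture.Theses.LinearSystemTorelli

/-!
# Route LinearSystemTorelli — `Assembly` (assembly item stmt-HodgeConjecture-1085)

The reusable reduction chain of route `LinearSystemTorelli` (shared verbatim with the retired route
`NodalSupport`):

  (∀ n X, nonempty_hodgeModel n X) → DivisorInduction → PencilReduction → HardLefschetzReduction →
    MiddleDivisorSupport → HodgeConjecture.

Proof (pure logic and `ℕ`-arithmetic, the same induction as the route's deciding theorem `closes`):
the cycle part `HC(n, p)` — every rational `(p,p)` class in `H^{2p}` of a smooth projective `n`-fold
is algebraic — is proved for all `(n, p)` by strong induction on the dimension `n` with an inner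
strong induction on the codimension `p`:
* `p = 0`: `algebraicClasses X 0 = ⊤` (`hodgeConjectureFor_codim_zero`);
* `n < 2p` (above the middle): `HardLefschetzReduction` from the inner hypothesis at `n - p < p`;
* `n = 2p` (the middle): `MiddleDivisorSupport` gives divisor support, then `DivisorInduction` with
  the outer hypothesis at `(n - 1, p - 1)`;
* `2p < n` (below the middle): `PencilReduction` with the outer hypothesis at `n - 1` (all
  codimensions) and the inner hypothesis at `p - 1`.
The anti-vacuity conjunct `Nonempty (HodgeModel n X)` of `HodgeConjectureFor` is the first antecedent
(`nonempty_hodgeModel`).  Self-contained: imports only this route's thesis file; no named facts.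
-/

noncomputable section

namespace Summit.HodgeConjecture.HodgeConjecture.Theorems

open Literature.AlgebraicGeometry.HodgeTheory Literature.AlgebraicGeometry.Motives

/-- **Item stmt-HodgeConjecture-1085 (`Assembly`)**: the reduction chain
`(∀ n X, nonempty_hodgeModel n X) → DivisorInduction → PencilReduction → HardLefschetzReduction →
MiddleDivisorSupport → HodgeConjecture` of route `LinearSystemTorelli`, by strong induction on the
dimension with an inner strong induction on the codimension (`p = 0` trivial; `n < 2p` hard
Lefschetz; `n = 2p` divisor support + divisor induction; `2p < n` Lefschetz pencils).  The type is
literally the route decl `Summit.HodgeConjecture.HodgeConjecture.Theses.LinearSystemTorelli.Assembly`.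
[cite: Thomas2005Nodes, Prop. 2 and Thm. 1] [cite: BrosnanFangNiePearlstein2009, Thm. 2] -/
theorem linearSystemTorelli_assembly_proof :
    Summit.HodgeConjecture.HodgeConjecture.Theses.LinearSystemTorelli.Assembly := by
  unfold Summit.HodgeConjecture.HodgeConjecture.Theses.LinearSystemTorelli.Assembly
  intro hM hDI hPR hHL hMid
  -- HC(n, p) for all n, p: strong induction on the dimension n, inner strong induction on p
  have key : ∀ (n p : ℕ) ⦃X : SchemeOver ℂ⦄, IsSmoothProjective n X →
      ∀ c : complexBetti X (2 * p), IsRationalClass c → IsOfHodgeType n X (2 * p) p p c →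
        c ∈ algebraicClasses X p := by
    intro n
    induction n using Nat.strong_induction_on with
    | _ n ihn =>
    intro p
    induction p using Nat.strong_induction_on with
    | _ p ihp =>
    intro X hX c hc hh
    rcases Nat.eq_zero_or_pos p with rfl | hp
    · -- codimension 0: algebraicClasses X 0 = ⊤
      exact hodgeConjectureFor_codim_zero c
    · rcases lt_trichotomy n (2 * p) with hlt | heq | hgt
      · -- above the middle (n < 2p): hard Lefschetz from codimension n - p < p
        exact hHL n p hlt hX (ihp (n - p) (by omega) hX) c hc hh
      · -- the middle degree (n = 2p): divisor support, then divisor induction from HC(n-1, p-1)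
        obtain ⟨n', rfl⟩ : ∃ n', n = n' + 1 := ⟨n - 1, by omega⟩
        have hX2 := hX
        have hh2 := hh
        rw [heq] at hX2 hh2
        exact hDI n' p hp (ihn n' (by omega) (p - 1)) hX c hc hh (hMid hp hX2 c hc hh2)
      · -- below the middle (2p < n): Lefschetz pencil from HC(n-1, all q) and HC(n, p-1)
        obtain ⟨m, rfl⟩ : ∃ m, n = m + 1 := ⟨n - 1, by omega⟩
        exact hPR m p hp (by omega) (fun Y hY q => ihn m (by omega) q hY) (ihp (p - 1) (by omega))
          hX c hc hh
  -- the summit statement: Hodge model (first antecedent) + the cycle part in every codimension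
  intro n X hX
  obtain ⟨A⟩ := (hM n X).nonempty hX
  exact (hodgeConjectureFor_iff_of_hodgeModel A).2 (fun p c hc hh => key n p hX c hc hh)

end Summit.HodgeConjecture.HodgeConjecture.Theorems

end
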